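import Mathlib
import HarnessLib

/-!
# Route NewtonUnitEquations — crux `TwoProducts` (stmt-ValiantsHypothesis-5906), line `formal-log-linearisation`: objects

Definitions file for the registered line `Cruxes/TwoProducts/Lines/formal-log-linearisation.lean`, whose four
"provable now" stubs (`stub_sectorDecomposition`, `stub_chartNormalisation`, `stub_logLinearisation`,
`stub_raysRung`) and open engine (`stub_logSumEngine`) are stated over twelve objects the line declares locally
(its § "Objects of the line"). This file puts them VERBATIM (same names, same bodies, same order) into an importable
module so that the line's stubs can be proved by name in `Theorems/`:

* `Expo` — exponent vectors `Fin 2 →₀ ℕ` of bivariate monomials;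
* `wt ξ e` — the real weight `ξ₀·e₀ + ξ₁·e₁`;
* `IsStrictTop ξ S l` — `l` is the strict `ξ`-top of the set `S`;
* `Cancelling f g a b` — a top-assignment whose two product top monomials cancel;
* `hidden f g a b` — the hidden vertices of the sector of the top-assignment `(a, b)`;
* `ValidWeight u v ξ` — `ξ` is negative on every tail exponent of the normalised instance `(u, v)`;
* `tailDiff u v` — `∏ (1 + u_j) − ∏ (1 + v_j)`;
* `visible u v` — strict tops of `supp (tailDiff u v)` over all valid weights;
* `logCoeff u n` — the coefficient of `X^n` in the formal logarithm `log (1 + u)` (a finite sum, exact by total-degree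
  truncation);
* `logDiff u v n` — the coefficient of `X^n` in `D = Σ_j log (1 + u_j) − Σ_j log (1 + v_j)`;
* `logSupport u v` — `supp D`;
* `logVisible u v` — strict tops of `supp D` over all valid weights.

No statement is asserted here. Honest framing: vocabulary only; the crux `TwoProducts` is OPEN (the line rests on
the open engine `stub_logSumEngine`), the line is not the item's skeleton of record, and nothing here bears on
`VP ≠ VNP`.
-/

noncomputable section

-- Sub = Summit single-conjunct layout: the duplicated namespace component is mandated by the tree.
set_option linter.dupNamespace false

namespace Summit.ValiantsHypothesis.ValiantsHypothesis.Theorems.NewtonUnitEquations.TwoProducts.FormalLogLinearisation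

open scoped BigOperators
open MvPolynomial

/-- Exponent vectors of bivariate monomials (verbatim the line's `Expo`). [folklore] -/
abbrev Expo := Fin 2 →₀ ℕ

/-- The weight `⟪ξ, e⟫ = ξ₀·e₀ + ξ₁·e₁` of an exponent vector for a real weight vector `ξ` (verbatim the line's
`wt`). [folklore] -/
def wt (ξ : Fin 2 → ℝ) (e : Expo) : ℝ := ξ 0 * ((e 0 : ℕ) : ℝ) + ξ 1 * ((e 1 : ℕ) : ℝ)

/-- `l` is the STRICT `ξ`-top of the set `S`: `l ∈ S` and every other point of `S` has smaller weight.
(For `S` = a support and `ξ` generic this says: `l` is the vertex of `conv S` exposed by `ξ`.) Verbatim the line's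
`IsStrictTop`. [folklore] -/
def IsStrictTop (ξ : Fin 2 → ℝ) (S : Set Expo) (l : Expo) : Prop :=
  l ∈ S ∧ ∀ μ ∈ S, μ ≠ l → wt ξ μ < wt ξ l

variable {m : ℕ}

/-- A top-assignment `(a, b)` (one exponent per factor) is CANCELLING when the two top monomials of the products
coincide with equal coefficients: `Σ a_j = Σ b_j` and `∏ [X^{a_j}] f_j = ∏ [X^{b_j}] g_j` (verbatim the line's
`Cancelling`). [folklore] -/
def Cancelling (f g : Fin m → MvPolynomial (Fin 2) ℂ) (a b : Fin m → Expo) : Prop :=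
  ∑ j, a j = ∑ j, b j ∧ ∏ j, coeff (a j) (f j) = ∏ j, coeff (b j) (g j)

/-- HIDDEN VERTICES of the sector of the top-assignment `(a, b)`: support points of `∏ f − ∏ g` that are the strict
`ξ`-top for some weight `ξ` making `a j` the strict top of `supp f_j` and `b j` the strict top of `supp g_j` for
every `j` (such `ξ` form one open arc of directions — the sector; empty set if no `ξ` realises `(a,b)`). Verbatim
the line's `hidden`. [folklore] -/
def hidden (f g : Fin m → MvPolynomial (Fin 2) ℂ) (a b : Fin m → Expo) : Set Expo :=
  {l | ∃ ξ : Fin 2 → ℝ, (∀ j, IsStrictTop ξ ↑(f j).support (a j)) ∧ (∀ j, IsStrictTop ξ ↑(g j).support (b j)) ∧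
    IsStrictTop ξ ↑(∏ j, f j - ∏ j, g j).support l}

/-- VALID WEIGHTS of a normalised instance `(u, v)` (tails): `ξ` is negative on every tail exponent, i.e. the
constant term is the strict `ξ`-top of every factor `1 + u_j`, `1 + v_j` (verbatim the line's `ValidWeight`).
[folklore] -/
def ValidWeight (u v : Fin m → MvPolynomial (Fin 2) ℂ) (ξ : Fin 2 → ℝ) : Prop :=
  (∀ j, ∀ e ∈ (u j).support, wt ξ e < 0) ∧ (∀ j, ∀ e ∈ (v j).support, wt ξ e < 0)

/-- The normalised difference of products `∏ (1 + u_j) − ∏ (1 + v_j)` (verbatim the line's `tailDiff`).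
[folklore] -/
def tailDiff (u v : Fin m → MvPolynomial (Fin 2) ℂ) : MvPolynomial (Fin 2) ℂ :=
  ∏ j, (1 + u j) - ∏ j, (1 + v j)

/-- VISIBLE VERTICES of a normalised instance: strict `ξ`-tops of `supp(∏(1+u) − ∏(1+v))` over all valid `ξ`
(verbatim the line's `visible`). [folklore] -/
def visible (u v : Fin m → MvPolynomial (Fin 2) ℂ) : Set Expo :=
  {l | ∃ ξ : Fin 2 → ℝ, ValidWeight u v ξ ∧ IsStrictTop ξ ↑(tailDiff u v).support l}

/-- The coefficient of `X^n` in the formal logarithm `log(1 + u) = Σ_{r ≥ 1} (−1)^{r+1} u^r / r` for a polynomial `u`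
with `u(0) = 0`: since every monomial of `u` has total degree `≥ 1`, only `r ≤ n₀ + n₁` contribute, so the series
coefficient is this FINITE sum (exact truncation by total degree; no `MvPowerSeries.log` needed). Verbatim the
line's `logCoeff`. [folklore] -/
def logCoeff (u : MvPolynomial (Fin 2) ℂ) (n : Expo) : ℂ :=
  ∑ r ∈ Finset.Icc 1 (n 0 + n 1), (-1 : ℂ) ^ (r + 1) / (r : ℂ) * coeff n (u ^ r)

/-- The log-sum `D = Σ_j log(1 + u_j) − Σ_j log(1 + v_j)`, coefficientwise (verbatim the line's `logDiff`).
[folklore] -/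
def logDiff (u v : Fin m → MvPolynomial (Fin 2) ℂ) (n : Expo) : ℂ :=
  ∑ j, logCoeff (u j) n - ∑ j, logCoeff (v j) n

/-- The support of the log-sum `D` (an infinite subset of `ℕ²` in general; verbatim the line's `logSupport`).
[folklore] -/
def logSupport (u v : Fin m → MvPolynomial (Fin 2) ℂ) : Set Expo :=
  {n | logDiff u v n ≠ 0}

/-- VISIBLE POINTS OF THE LOG-SUM: strict `ξ`-tops of `supp D` over all valid weights `ξ` (the vertices of the
Newton polyhedron `conv(supp D) + (recession cone)` seen from the sector; verbatim the line's `logVisible`).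
[folklore] -/
def logVisible (u v : Fin m → MvPolynomial (Fin 2) ℂ) : Set Expo :=
  {l | ∃ ξ : Fin 2 → ℝ, ValidWeight u v ξ ∧ IsStrictTop ξ (logSupport u v) l}

end Summit.ValiantsHypothesis.ValiantsHypothesis.Theorems.NewtonUnitEquations.TwoProducts.FormalLogLinearisation

end
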